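import Mathlib
import Summits.NavierStokesRegularity.NavierStokesRegularity.Theorems.FilamentSkeletonRssSkeletonJ1RSplit
import Summits.NavierStokesRegularity.NavierStokesRegularity.Theorems.FilamentSkeletonRssNormalBlockMatchedL
import Summits.NavierStokesRegularity.NavierStokesRegularity.Theorems.FilamentSkeletonRssSkeletonJ1RLineDefs
import Summits.NavierStokesRegularity.NavierStokesRegularity.Theorems.FilamentSkeletonRssSkeletonJ1RLiaFrameExists
import Summits.NavierStokesRegularity.NavierStokesRegularity.Theorems.FilamentSkeletonRssSkeletonJ1RFlatOutput
import Summits.NavierStokesRegularity.NavierStokesRegularity.Theorems.FilamentSkeletonRssSkeletonJ1RLiaDefectB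
import Summits.NavierStokesRegularity.NavierStokesRegularity.Theorems.FilamentSkeletonRssSkeletonJ1RLiaDefectDeriv
import Summits.NavierStokesRegularity.NavierStokesRegularity.Theorems.FilamentSkeletonRssSkeletonJ1RReferenceInjectivityOfCoreL1

/-!
# Crux `SkeletonJ1R` (stmt-NavierStokesRegularity-23610) · registered line `streamline_kantorovich_R` (skeleton v7 4b067f5f13f71d7e) —
# REGISTERED STATUS after F2-d: the open content of the line is `FineFixedPointL` (+ the shared 13-R item), kernel-visibly

Hand `leafhand-ns-filamentskeletonrs-1` g2 (prover), 2026-08-31, `--supports stmt-NavierStokesRegularity-23610`.  MODEL rung, NEGATIVE side of the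
NS ladder: statements about a HYPOTHETICAL filament-type rotating-self-similar blow-up skeleton; nothing here proves or refutes any statement about
Navier–Stokes regularity; the crux ⟨23610⟩, its heart ⟨23320⟩ and 13-R ⟨23612⟩ stay OPEN.

WHAT.  Of the v7 skeleton's four stubs, F2-d `stub_liaDefectDerivBL` is a theorem (p818791); the open ones are L-core′ `CorePinningL1`, K-B′
`KantorovichClosingBL1` and 13-R (= item ⟨23612⟩ by name).  Since F1 (`stub_liaFrameExistsL`), F2-B (`stub_liaDefectBL`) and F2-d are theorems,
the registered pair (L-core′, K-B′) is — as far as the composition `SkeletonJ1R_of` uses it — ONE statement, the closing's output shape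
`FineFixedPointL` of `…SkeletonJ1RLineDefs` §2:

* `kantorovichClosingBL1_iff` : `KantorovichClosingBL1 ↔ (ReferenceInjectivityL1 → FineFixedPointL)` (the three landed hypotheses discharged);
* `kantorovichClosingBL1_of_fineFixedPointL` : `FineFixedPointL → KantorovichClosingBL1`, and
  `fineFixedPointL_of_registered` : `CorePinningL1 → KantorovichClosingBL1 → FineFixedPointL` — so `FineFixedPointL` is SANDWICHED between K-B′ alone
  and the registered pair;
* `tangentSkeletonNearStraightL_of_fineFixedPointL` : `FineFixedPointL →` the heart ⟨23320⟩ `TangentSkeletonNearStraightL` BY NAME (frame F1 + flat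
  output D, both landed; the threading of `Rb₁`/`Γ₂` is the skeleton's `tangentSkeletonNearStraightLS_of` with the K-B′ seam replaced by the output shape);
* `skeletonJ1R_of_fineFixedPointL` : `FineFixedPointL → Clause13RNearStraightL → SkeletonJ1R` — THE CRUX BY NAME from the output shape and the 13-R
  item alone (normal block ⟨23322⟩ landed, split glue `skeletonJ1R_of_children` landed);
* `skeletonJ1R_of_registered` : `CorePinningL1 → KantorovichClosingBL1 → Clause13RNearStraightL → SkeletonJ1R` — the registered skeleton's
  composition restated as an importable sorry-free theorem over the three OPEN stub statements (the skeleton file itself carries `sorry`s).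

So a prover who reaches `FineFixedPointL` by ANY route (Kantorovich at the LIA reference, Leray–Schauder in the switch-on time, a direct shooting
construction) closes K-B′ by name and makes L-core′ unnecessary for the crux; conversely nothing weaker than `FineFixedPointL` is extracted from
the pair by the skeleton.  No new mathematics: bookkeeping over landed theorems, recorded so that the planners' sizing of the open set is a
kernel fact. [folklore]
-/

set_option linter.dupNamespace false

noncomputable section

namespace Summit.NavierStokesRegularity.NavierStokesRegularity.Theorems.SkeletonJ1RFrame.RegisteredV7

open Set Function Filter Real
open Summit.NavierStokesRegularity.NavierStokesRegularity.Theorems.SkeletonJ1RFrame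
open Summit.NavierStokesRegularity.NavierStokesRegularity.Theorems.FilamentSkeletonRssSkeletonJ1GSplit (NearStraightJ1G StraightDatum)
open Summit.NavierStokesRegularity.NavierStokesRegularity.Theorems.FilamentSkeletonRssSkeletonJ1LSplit
  (FlatJ1L TangentSkeletonNearStraightLS route_tangentSkeletonNearStraightL_iff)
open scoped InnerProductSpace

/-- K-B′ with its three LANDED hypotheses discharged: `KantorovichClosingBL1 ↔ (ReferenceInjectivityL1 → FineFixedPointL)`
(F1 `stub_liaFrameExistsL`, F2-B `stub_liaDefectBL`, F2-d `stub_liaDefectDerivBL` are theorems of the tree). [folklore] -/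
theorem kantorovichClosingBL1_iff : KantorovichClosingBL1 ↔ (ReferenceInjectivityL1 → FineFixedPointL) :=
  ⟨fun hK hL => hK stub_liaFrameExistsL stub_liaDefectBL stub_liaDefectDerivBL hL, fun h _ _ _ hL => h hL⟩

/-- The output shape implies K-B′ outright (K-B′ is an implication with conclusion `FineFixedPointL`). [folklore] -/
theorem kantorovichClosingBL1_of_fineFixedPointL (h : FineFixedPointL) : KantorovichClosingBL1 :=
  fun _ _ _ _ => h

/-- The registered pair (L-core′, K-B′) yields the output shape: L′ from L-core′ by the landed glue `referenceInjectivityL1_of_core`, then K-B′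
with F1, F2-B, F2-d landed. [folklore] -/
theorem fineFixedPointL_of_registered (hcore : CorePinningL1) (hK : KantorovichClosingBL1) : FineFixedPointL :=
  kantorovichClosingBL1_iff.mp hK (referenceInjectivityL1_of_core hcore)

/-- Hence, GIVEN L-core′, K-B′ is equivalent to the output shape. [folklore] -/
theorem kantorovichClosingBL1_iff_fineFixedPointL_of_core (hcore : CorePinningL1) : KantorovichClosingBL1 ↔ FineFixedPointL :=
  ⟨fineFixedPointL_of_registered hcore, kantorovichClosingBL1_of_fineFixedPointL⟩

/-- The structured heart `TangentSkeletonNearStraightLS` from the output shape ALONE: the frame (F1, landed) at every `Γ ≥ Γ₁`, the fine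
switched-tangent skeleton with regular waists in that frame (the hypothesis), booked by the flat output (D, landed) at `λ = 1`.  Constants threaded
as in the registered skeleton: `Rb₁ := min Rb₁ᴰ (min Rb₁ᶠ Rb₁ᴷ)`, `Γ₂ := max Γ₁ᶠ (max Γ₂ᴷ Γ₃ᴰ)`. [folklore] -/
theorem tangentSkeletonNearStraightLS_of_fineFixedPointL (hFP : FineFixedPointL) : TangentSkeletonNearStraightLS := by
  intro N δd ρd Λd Rwd θd mw p t γ α s₀ hN hδ hρ hRw hθ hmw hSD hGP
  obtain ⟨δ, ρ, K, Λ, Rw, cg, θ₀, KA, RbD, hδ', hρ', hRw', hcg, hθ₀', hRbD, hKρ, hDfam⟩ :=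
    stub_flatOutputL N δd ρd Λd Rwd θd mw p t γ α s₀ hN hδ hρ hRw hθ hmw hSD hGP
  obtain ⟨RbF, hRbF, hFfam⟩ := stub_liaFrameExistsL N δd ρd Λd Rwd θd mw p t γ α s₀ hN hδ hρ hRw hθ hmw hSD hGP
  obtain ⟨RbK, hRbK, hKfam⟩ := hFP N δd ρd Λd Rwd θd mw p t γ α s₀ hN hδ hρ hRw hθ hmw hSD hGP
  refine ⟨δ, ρ, K, Λ, Rw, cg, θ₀, KA, min RbD (min RbF RbK), hδ', hρ', hRw', hcg, hθ₀',
    lt_min hRbD (lt_min hRbF hRbK), hKρ, ?_⟩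
  intro Rb hRb hRb₁
  have hRbD' : Rb ≤ RbD := le_trans hRb₁ (min_le_left _ _)
  have hRbF' : Rb ≤ RbF := le_trans hRb₁ (le_trans (min_le_right _ _) (min_le_left _ _))
  have hRbK' : Rb ≤ RbK := le_trans hRb₁ (le_trans (min_le_right _ _) (min_le_right _ _))
  obtain ⟨Γ₁, hframe⟩ := hFfam Rb hRb hRbF'
  obtain ⟨Γ₂, hfix⟩ := hKfam Rb hRb hRbK'
  obtain ⟨Γ₃, hout⟩ := hDfam 1 Rb one_pos hRb hRbD'
  refine ⟨max Γ₁ (max Γ₂ Γ₃), fun Γ hΓ => ?_⟩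
  have hΓ₁ : Γ₁ ≤ Γ := le_trans (le_max_left _ _) hΓ
  have hΓ₂ : Γ₂ ≤ Γ := le_trans (le_trans (le_max_left _ _) (le_max_right _ _)) hΓ
  have hΓ₃ : Γ₃ ≤ Γ := le_trans (le_trans (le_max_right _ _) (le_max_right _ _)) hΓ
  obtain ⟨x, M, hx, hxM⟩ := hframe Γ hΓ₁
  obtain ⟨X, hfine, htan, hreg⟩ := hfix Γ hΓ₂ x M hx hxM
  obtain ⟨w, c, Aa, hflat, hns⟩ := hout Γ hΓ₃ x M hxM X hfine htan hreg
  exact ⟨X, w, c, Aa, hflat, hns⟩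

/-- The heart ⟨stmt-NavierStokesRegularity-23320⟩ `TangentSkeletonNearStraightL` BY NAME from the output shape (`Iff.rfl` certificate
`route_tangentSkeletonNearStraightL_iff`). [folklore] -/
theorem tangentSkeletonNearStraightL_of_fineFixedPointL (hFP : FineFixedPointL) :
    Summit.NavierStokesRegularity.NavierStokesRegularity.Theses.FilamentSkeletonRss.TangentSkeletonNearStraightL :=
  route_tangentSkeletonNearStraightL_iff.mpr (tangentSkeletonNearStraightLS_of_fineFixedPointL hFP)

/-- **The crux ⟨stmt-NavierStokesRegularity-23610⟩ `SkeletonJ1R` BY NAME from the output shape `FineFixedPointL` and the 13-R item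
⟨stmt-NavierStokesRegularity-23612⟩ alone** (normal block ⟨23322⟩ `stub_normalBlockL` landed, split glue `skeletonJ1R_of_children` landed).
The open content of the registered line is exactly this pair. [folklore] -/
theorem skeletonJ1R_of_fineFixedPointL (hFP : FineFixedPointL)
    (h13R : Summit.NavierStokesRegularity.NavierStokesRegularity.Theses.FilamentSkeletonRss.Clause13RNearStraightL) :
    Summit.NavierStokesRegularity.NavierStokesRegularity.Theses.FilamentSkeletonRss.SkeletonJ1R :=
  Summit.NavierStokesRegularity.NavierStokesRegularity.Theorems.FilamentSkeletonRssSkeletonJ1RSplit.skeletonJ1R_of_children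
    (tangentSkeletonNearStraightL_of_fineFixedPointL hFP) h13R
    Summit.NavierStokesRegularity.NavierStokesRegularity.Theorems.FilamentSkeletonRssNormalBlockMatchedL.stub_normalBlockL

/-- The registered skeleton's composition as an importable sorry-free theorem over its three OPEN stub statements (L-core′, K-B′, 13-R):
`CorePinningL1 → KantorovichClosingBL1 → Clause13RNearStraightL → SkeletonJ1R`. [folklore] -/
theorem skeletonJ1R_of_registered (hcore : CorePinningL1) (hK : KantorovichClosingBL1)
    (h13R : Summit.NavierStokesRegularity.NavierStokesRegularity.Theses.FilamentSkeletonRss.Clause13RNearStraightL) :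
    Summit.NavierStokesRegularity.NavierStokesRegularity.Theses.FilamentSkeletonRss.SkeletonJ1R :=
  skeletonJ1R_of_fineFixedPointL (fineFixedPointL_of_registered hcore hK) h13R

end Summit.NavierStokesRegularity.NavierStokesRegularity.Theorems.SkeletonJ1RFrame.RegisteredV7

end
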